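import Summits.CriticalPhenomena.PercolationContinuityZ3.Theorems.Transplant.FKConnectivityAllQForestTwoCellBound
import Summits.CriticalPhenomena.PercolationContinuityZ3.Theorems.Transplant.FKConnectivityAllQForestNearHubReductions
import Summits.CriticalPhenomena.PercolationContinuityZ3.Theorems.Transplant.FKConnectivityAllQForestTreeLevelSteps
import HarnessLib

/-!
# CONJECTURE H1′ IMPLIES THE SQUARE-FREE ADJACENT FOREST RAYLEIGH NODE (part 1 of 2: the level-free elimination steps)

Support file (`--supports stmt-CriticalPhenomena-4575`), FK sub-lane `prim-bschramm-fk-1` (generation 30) of the post-continuity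
programme; builds on p205010 (kernel theorem, internal audit signed; external expert review pending).  No definitions, no named facts,
no sorries; standard axioms.

THE ARROW (memo bschramm/FROM-fk-1-g30-LAMAN-IDENTITIES.md §4).  Strong induction on the size of a support `S` of the fibre `(M, u₀)`:
(0) `e` or `f` not free ⇒ trivial (as in g29's tree level); (1) at or above the tight level ⇒ the TREE LEVEL (`adjForestNoSq_fibre_of_tight`,
g29); (2) a far vertex of weighted degree ≤ 2 ⇒ level-free eliminations (**`node_of_farVertex_le_two`**: isolated / pendant free
(`fibreCount_forest_pendantFree`) / two free (`twoCellBound_step_degTwo`) / pendant pinned (**`node_step_pendant`**)); (3) the hub of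
weighted degree two ⇒ `adjForestNoSq_fibre_of_hubDegTwo`; an end `v` or `y` of weighted degree ≤ 2 ⇒ `adjForestNoSq_bad_eq_good_of_pendantEnd`
or the SERIES REDUCTION `adjForestNoSq_fibre_of_seriesEnd` (or the triangle theorem when the end is joined to the other end);
(4) otherwise every vertex of `S` has weighted degree ≥ 3 and the COUNTING LEMMA (**`exists_deg_three_not_adj_hub`**: below the tight level
`Σ wdeg ≤ 4|S| − 6`, so the weighted-degree-3 vertices cannot all be joined to `o`) yields a vertex `z ∉ {o, v, y}` of weighted degree
3 not joined to `o`; it is mixed (one free + one pinned pair: **`node_step_mixed`**, two pair cells) or carries three free pairs — and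
there, and only there, CONJECTURE H1′ (`TwoCellBoundOn V`, via `twoCellBound_step_claw`) is used (**`node_of_farVertex_three`**).
Main results: **`adjForestRayleighNoSqOn_of_twoCellBound`**, **`adjForestRayleighNoSqPos_of_twoCellBoundPos`**.
[cite: CibulkaHladkyLaCroixWagner2008, Thm. 1 (p. 2), Cases 0–3 (pp. 4–5)] [cite: SempleWelsh2008, Conj. 1.1 (p. 2); Thm. 4.2 (p. 11)]
[cite: Linusson2011, Prop. 2.6] [cite: Grimmett2006, §1.5 (p. 13)]
-/

noncomputable section

namespace Summit.CriticalPhenomena.PercolationContinuityZ3.Theorems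
namespace FK

open MeasureTheory Set Literature.Probability.LatticeModels Literature.Probability.Percolation
open scoped Classical symmDiff

variable {V : Type*} [Fintype V]

/-! ### Level-free pendant-pinned and mixed steps -/

section Steps

variable {M' u₀ : BondConfig V} {T : Finset V} {o v y : V}

/-- **Pendant pinned step, level-free** (far vertex carrying one pinned pair only).
[cite: CibulkaHladkyLaCroixWagner2008, §2 (p. 3)] [cite: Linusson2011, Prop. 2.6] -/
theorem node_step_pendant
    (IH : ∀ (N u : BondConfig V), Disjoint u N → (∀ g ∈ N ∪ u, ∀ w ∈ g, w ∈ T) →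
      fibreCount N u (forestEv V ∩ {ω | s(o, v) ∈ ω ∧ s(o, y) ∈ ω}) (forestEv V) ≤
        fibreCount N u (forestEv V ∩ {ω | s(o, v) ∈ ω}) (forestEv V ∩ {ω | s(o, y) ∈ ω}))
    {z h : V} (hd : Disjoint u₀ M') (hz : ∀ g ∈ M' ∪ u₀, z ∉ g) (hzh : z ≠ h) (hzo : z ≠ o) (hzv : z ≠ v) (hzy : z ≠ y)
    (hT : ∀ g ∈ M' ∪ u₀, ∀ w ∈ g, w ∈ T) :
    fibreCount M' (insert s(z, h) u₀) (forestEv V ∩ {ω | s(o, v) ∈ ω ∧ s(o, y) ∈ ω}) (forestEv V) ≤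
      fibreCount M' (insert s(z, h) u₀) (forestEv V ∩ {ω | s(o, v) ∈ ω}) (forestEv V ∩ {ω | s(o, y) ∈ ω}) := by
  have hPh := insert_mem_pairEv₂_iff (mk_ne_of_far (a := h) hzo hzv) (mk_ne_of_far (a := h) hzo hzy)
  have hEh := insert_mem_pairEv_iff (mk_ne_of_far (a := h) hzo hzv)
  have hFh := insert_mem_pairEv_iff (mk_ne_of_far (a := h) hzo hzy)
  have hU : ∀ ω, insert s(z, h) ω ∈ (univ : Set (BondConfig V)) ↔ ω ∈ (univ : Set (BondConfig V)) := fun _ => by simp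
  have hb0 : fibreCount M' (insert s(z, h) u₀) (forestEv V ∩ {ω | s(o, v) ∈ ω ∧ s(o, y) ∈ ω}) (forestEv V) =
      fibreCount M' (insert s(z, h) u₀) (forestEv V ∩ {ω | s(o, v) ∈ ω ∧ s(o, y) ∈ ω}) (forestEv V ∩ univ) := by
    rw [inter_univ]
  rw [hb0, fibreCount_forest_pendantPinned hz hzh hPh hU, fibreCount_forest_pendantPinned hz hzh hEh hFh, inter_univ]
  exact IH M' u₀ hd hT

/-- **Mixed step, level-free** (far vertex carrying one free and one pinned pair: two pair cells).
[cite: CibulkaHladkyLaCroixWagner2008, Case 3 (pp. 4–5)] [cite: Linusson2011, Prop. 2.6] -/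
theorem node_step_mixed
    (IH : ∀ (N u : BondConfig V), Disjoint u N → (∀ g ∈ N ∪ u, ∀ w ∈ g, w ∈ T) →
      fibreCount N u (forestEv V ∩ {ω | s(o, v) ∈ ω ∧ s(o, y) ∈ ω}) (forestEv V) ≤
        fibreCount N u (forestEv V ∩ {ω | s(o, v) ∈ ω}) (forestEv V ∩ {ω | s(o, y) ∈ ω}))
    {z h i : V} (hd : Disjoint u₀ M') (hz : ∀ g ∈ M' ∪ u₀, z ∉ g) (hzh : z ≠ h) (hzi : z ≠ i) (hhi : h ≠ i)
    (hzo : z ≠ o) (hzv : z ≠ v) (hzy : z ≠ y) (hT : ∀ g ∈ M' ∪ u₀, ∀ w ∈ g, w ∈ T) (hh : h ∈ T) (hi : i ∈ T)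
    (he : s(o, v) ∈ M') (hf : s(o, y) ∈ M') (hvy : v ≠ y) :
    fibreCount (insert s(z, i) M') (insert s(z, h) u₀) (forestEv V ∩ {ω | s(o, v) ∈ ω ∧ s(o, y) ∈ ω}) (forestEv V) ≤
      fibreCount (insert s(z, i) M') (insert s(z, h) u₀) (forestEv V ∩ {ω | s(o, v) ∈ ω}) (forestEv V ∩ {ω | s(o, y) ∈ ω}) := by
  have hPi := insert_mem_pairEv₂_iff (mk_ne_of_far (a := i) hzo hzv) (mk_ne_of_far (a := i) hzo hzy)
  have hPh := insert_mem_pairEv₂_iff (mk_ne_of_far (a := h) hzo hzv) (mk_ne_of_far (a := h) hzo hzy)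
  have hEi := insert_mem_pairEv_iff (mk_ne_of_far (a := i) hzo hzv)
  have hEh := insert_mem_pairEv_iff (mk_ne_of_far (a := h) hzo hzv)
  have hFi := insert_mem_pairEv_iff (mk_ne_of_far (a := i) hzo hzy)
  have hFh := insert_mem_pairEv_iff (mk_ne_of_far (a := h) hzo hzy)
  have hU : ∀ x : V, ∀ ω, insert s(z, x) ω ∈ (univ : Set (BondConfig V)) ↔ ω ∈ (univ : Set (BondConfig V)) := fun _ _ => by simp
  have hb0 : fibreCount (insert s(z, i) M') (insert s(z, h) u₀) (forestEv V ∩ {ω | s(o, v) ∈ ω ∧ s(o, y) ∈ ω}) (forestEv V) =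
      fibreCount (insert s(z, i) M') (insert s(z, h) u₀) (forestEv V ∩ {ω | s(o, v) ∈ ω ∧ s(o, y) ∈ ω}) (forestEv V ∩ univ) := by
    rw [inter_univ]
  rw [hb0, fibreCount_forest_mixed_decomp hz hzh hzi hhi hPi hPh (hU i) (hU h),
    fibreCount_forest_mixed_decomp hz hzh hzi hhi hEi hEh hFi hFh]
  exact pairCell_le IH hd hT he hf hvy hh hi hhi

end Steps

/-! ### Far vertices of small weighted degree -/

section Far

variable {M u₀ : BondConfig V} {S : Finset V} {o v y z : V}

/-- **A far vertex of weighted degree at most two** (no conjecture needed): isolated, pendant free, two free, or pendant pinned.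
[cite: CibulkaHladkyLaCroixWagner2008, Cases 0–2 (p. 4)] [cite: Linusson2011, Prop. 2.6] -/
theorem node_of_farVertex_le_two
    (IH : ∀ (N u : BondConfig V), Disjoint u N → (∀ g ∈ N ∪ u, ∀ w ∈ g, w ∈ S.erase z) →
      fibreCount N u (forestEv V ∩ {ω | s(o, v) ∈ ω ∧ s(o, y) ∈ ω}) (forestEv V) ≤
        fibreCount N u (forestEv V ∩ {ω | s(o, v) ∈ ω}) (forestEv V ∩ {ω | s(o, y) ∈ ω}))
    (hd : Disjoint u₀ M) (hS : ∀ g ∈ M ∪ u₀, ∀ w ∈ g, w ∈ S) (hdiag : ∀ g ∈ M ∪ u₀, ¬ g.IsDiag)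
    (heM : s(o, v) ∈ M) (hfM : s(o, y) ∈ M) (hvy : v ≠ y) (hzo : z ≠ o) (hzv : z ≠ v) (hzy : z ≠ y)
    (hdegz : ((toFinite M).toFinset.filter fun g => z ∈ g).card + 2 * ((toFinite u₀).toFinset.filter fun g => z ∈ g).card ≤ 2) :
    fibreCount M u₀ (forestEv V ∩ {ω | s(o, v) ∈ ω ∧ s(o, y) ∈ ω}) (forestEv V) ≤
      fibreCount M u₀ (forestEv V ∩ {ω | s(o, v) ∈ ω}) (forestEv V ∩ {ω | s(o, y) ∈ ω}) := by
  have hMd : ∀ g ∈ M, ¬ g.IsDiag := fun g hg => hdiag g (Or.inl hg)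
  have hUd : ∀ g ∈ u₀, ¬ g.IsDiag := fun g hg => hdiag g (Or.inr hg)
  have hT_of : ∀ {N u : BondConfig V}, (∀ g ∈ N ∪ u, g ∈ M ∪ u₀) → (∀ g ∈ N ∪ u, z ∉ g) →
      ∀ g ∈ N ∪ u, ∀ w ∈ g, w ∈ S.erase z := fun hsub hz' g hg w hw =>
    Finset.mem_erase.2 ⟨fun h => hz' g hg (h ▸ hw), hS g (hsub g hg) w hw⟩
  have memS : ∀ {x : V}, s(z, x) ∈ M ∪ u₀ → x ∈ S.erase z := fun {x} hx =>
    Finset.mem_erase.2 ⟨fun h => hdiag _ hx (Sym2.mk_isDiag_iff.2 h.symm), hS _ hx x (Sym2.mem_mk_right _ _)⟩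
  have he_ne : ∀ x : V, s(z, x) ≠ s(o, v) := fun x => mk_ne_of_far hzo hzv
  have hf_ne : ∀ x : V, s(z, x) ≠ s(o, y) := fun x => mk_ne_of_far hzo hzy
  rcases Nat.lt_or_ge ((toFinite u₀).toFinset.filter fun g => z ∈ g).card 1 with hb0 | hb1
  · have hzu := isolated_of_card_filter_eq_zero (M := u₀) (z := z) (by omega)
    rcases Nat.lt_or_ge ((toFinite M).toFinset.filter fun g => z ∈ g).card 1 with ha0 | ha1
    · -- isolated: the same fibre has support `S ∖ z`
      have hzM := isolated_of_card_filter_eq_zero (M := M) (z := z) (by omega)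
      exact IH M u₀ hd (hT_of (fun g hg => hg) (fun g hg => hg.elim (hzM g) (hzu g)))
    rcases Nat.lt_or_ge ((toFinite M).toFinset.filter fun g => z ∈ g).card 2 with ha1' | ha2
    · -- one free pair: both counts double
      obtain ⟨c, hzc, hzcM, honly⟩ := exists_of_card_filter_eq_one (z := z) hMd (by omega)
      have hM : insert s(z, c) (M \ {s(z, c)}) = M := by rw [insert_sdiff_singleton, insert_eq_of_mem hzcM]
      have hz' : ∀ g ∈ M \ {s(z, c)} ∪ u₀, z ∉ g := fun g hg hzg =>
        hg.elim (fun hg => hg.2 (honly g hg.1 hzg)) (fun hg => hzu g hg hzg)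
      have hd' : Disjoint u₀ (M \ {s(z, c)}) := hd.mono_right sdiff_subset
      have hT' := hT_of (N := M \ {s(z, c)}) (u := u₀) (fun g hg => hg.elim (fun h => Or.inl h.1) Or.inr) hz'
      have hPc := insert_mem_pairEv₂_iff (he_ne c) (hf_ne c)
      have hEc := insert_mem_pairEv_iff (V := V) (he_ne c)
      have hFc := insert_mem_pairEv_iff (V := V) (hf_ne c)
      have hU : ∀ ω, insert s(z, c) ω ∈ (univ : Set (BondConfig V)) ↔ ω ∈ (univ : Set (BondConfig V)) := fun _ => by simp
      have hb : fibreCount M u₀ (forestEv V ∩ {ω | s(o, v) ∈ ω ∧ s(o, y) ∈ ω}) (forestEv V) =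
          2 * fibreCount (M \ {s(z, c)}) u₀ (forestEv V ∩ {ω | s(o, v) ∈ ω ∧ s(o, y) ∈ ω}) (forestEv V ∩ univ) := by
        rw [← fibreCount_forest_pendantFree hz' hzc hPc hU, hM, inter_univ]
      have hg : fibreCount M u₀ (forestEv V ∩ {ω | s(o, v) ∈ ω}) (forestEv V ∩ {ω | s(o, y) ∈ ω}) =
          2 * fibreCount (M \ {s(z, c)}) u₀ (forestEv V ∩ {ω | s(o, v) ∈ ω}) (forestEv V ∩ {ω | s(o, y) ∈ ω}) := by
        rw [← fibreCount_forest_pendantFree hz' hzc hEc hFc, hM]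
      rw [hb, hg, inter_univ]
      exact Nat.mul_le_mul_left 2 (IH _ _ hd' hT')
    · -- two free pairs
      obtain ⟨a, b, hza, hzb, hab, haM, hbM, honly⟩ := exists_of_card_filter_eq_two (z := z) hMd (by omega)
      have hab' : s(z, a) ≠ s(z, b) := fun h => hab (Sym2.congr_right.1 h)
      have h1 : s(z, a) ∉ insert s(z, b) (M \ {s(z, a), s(z, b)}) := fun h => by
        rcases mem_insert_iff.1 h with h | h
        · exact hab' h
        · exact h.2 (mem_insert _ _)
      have hM : insert s(z, a) (insert s(z, b) (M \ {s(z, a), s(z, b)})) = M := by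
        ext g
        simp only [mem_insert_iff, mem_sdiff, mem_singleton_iff]
        constructor
        · rintro (rfl | rfl | ⟨hg, -⟩) <;> assumption
        · intro hg
          by_cases h1 : g = s(z, a)
          · exact Or.inl h1
          by_cases h2 : g = s(z, b)
          · exact Or.inr (Or.inl h2)
          · exact Or.inr (Or.inr ⟨hg, fun h => h.elim h1 h2⟩)
      have hz' : ∀ g ∈ M \ {s(z, a), s(z, b)} ∪ u₀, z ∉ g := fun g hg hzg =>
        hg.elim (fun hg => hg.2 (honly g hg.1 hzg)) (fun hg => hzu g hg hzg)
      have hd' : Disjoint u₀ (M \ {s(z, a), s(z, b)}) := hd.mono_right sdiff_subset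
      have hT' := hT_of (N := M \ {s(z, a), s(z, b)}) (u := u₀) (fun g hg => hg.elim (fun h => Or.inl h.1) Or.inr) hz'
      have he' : s(o, v) ∈ M \ {s(z, a), s(z, b)} := ⟨heM, fun h => by rcases h with h | h <;> exact he_ne _ h.symm⟩
      have hf' : s(o, y) ∈ M \ {s(z, a), s(z, b)} := ⟨hfM, fun h => by rcases h with h | h <;> exact hf_ne _ h.symm⟩
      have key := twoCellBound_step_degTwo IH hd' hz' hza hzb hab hzo hzv hzy hT' (memS (Or.inl haM)) (memS (Or.inl hbM)) he' hf' hvy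
      rw [hM] at key
      exact key
  · -- one pinned pair only
    obtain ⟨h, hzh, hzhU, honlyU⟩ := exists_of_card_filter_eq_one (z := z) (M := u₀) hUd (by omega)
    have hU : insert s(z, h) (u₀ \ {s(z, h)}) = u₀ := by rw [insert_sdiff_singleton, insert_eq_of_mem hzhU]
    have hUz : ∀ g ∈ u₀ \ {s(z, h)}, z ∉ g := fun g hg hzg => hg.2 (honlyU g hg.1 hzg)
    have hzM := isolated_of_card_filter_eq_zero (M := M) (z := z) (by omega)
    have hz' : ∀ g ∈ M ∪ (u₀ \ {s(z, h)}), z ∉ g := fun g hg => hg.elim (hzM g) (hUz g)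
    have hd' : Disjoint (u₀ \ {s(z, h)}) M := hd.mono_left sdiff_subset
    have hT' := hT_of (N := M) (u := u₀ \ {s(z, h)}) (fun g hg => hg.elim Or.inl (fun h => Or.inr h.1)) hz'
    have key := node_step_pendant (o := o) (v := v) (y := y) IH hd' hz' hzh hzo hzv hzy hT'
    rw [hU] at key
    exact key

/-- **A far vertex of weighted degree three NOT joined to the hub** (here CONJECTURE H1′ is used for three free pairs; the mixed case
is two pair cells). [cite: CibulkaHladkyLaCroixWagner2008, Case 3 (pp. 4–5)] [cite: SempleWelsh2008, Conj. 1.1 (p. 2)] [cite: Linusson2011, Prop. 2.6] -/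
theorem node_of_farVertex_three (hH : TwoCellBoundOn V)
    (IH : ∀ (N u : BondConfig V), Disjoint u N → (∀ g ∈ N ∪ u, ∀ w ∈ g, w ∈ S.erase z) →
      fibreCount N u (forestEv V ∩ {ω | s(o, v) ∈ ω ∧ s(o, y) ∈ ω}) (forestEv V) ≤
        fibreCount N u (forestEv V ∩ {ω | s(o, v) ∈ ω}) (forestEv V ∩ {ω | s(o, y) ∈ ω}))
    (hd : Disjoint u₀ M) (hS : ∀ g ∈ M ∪ u₀, ∀ w ∈ g, w ∈ S) (hdiag : ∀ g ∈ M ∪ u₀, ¬ g.IsDiag)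
    (heM : s(o, v) ∈ M) (hfM : s(o, y) ∈ M) (hvy : v ≠ y) (hzo : z ≠ o) (hzv : z ≠ v) (hzy : z ≠ y)
    (hoz : s(o, z) ∉ M ∪ u₀)
    (hdegz : ((toFinite M).toFinset.filter fun g => z ∈ g).card + 2 * ((toFinite u₀).toFinset.filter fun g => z ∈ g).card = 3) :
    fibreCount M u₀ (forestEv V ∩ {ω | s(o, v) ∈ ω ∧ s(o, y) ∈ ω}) (forestEv V) ≤
      fibreCount M u₀ (forestEv V ∩ {ω | s(o, v) ∈ ω}) (forestEv V ∩ {ω | s(o, y) ∈ ω}) := by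
  have hMd : ∀ g ∈ M, ¬ g.IsDiag := fun g hg => hdiag g (Or.inl hg)
  have hUd : ∀ g ∈ u₀, ¬ g.IsDiag := fun g hg => hdiag g (Or.inr hg)
  have hT_of : ∀ {N u : BondConfig V}, (∀ g ∈ N ∪ u, g ∈ M ∪ u₀) → (∀ g ∈ N ∪ u, z ∉ g) →
      ∀ g ∈ N ∪ u, ∀ w ∈ g, w ∈ S.erase z := fun hsub hz' g hg w hw =>
    Finset.mem_erase.2 ⟨fun h => hz' g hg (h ▸ hw), hS g (hsub g hg) w hw⟩
  have memS : ∀ {x : V}, s(z, x) ∈ M ∪ u₀ → x ∈ S.erase z := fun {x} hx =>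
    Finset.mem_erase.2 ⟨fun h => hdiag _ hx (Sym2.mk_isDiag_iff.2 h.symm), hS _ hx x (Sym2.mem_mk_right _ _)⟩
  have he_ne : ∀ x : V, s(z, x) ≠ s(o, v) := fun x => mk_ne_of_far hzo hzv
  have hf_ne : ∀ x : V, s(z, x) ≠ s(o, y) := fun x => mk_ne_of_far hzo hzy
  -- a pair `zx` of the fibre has `x ≠ o`
  have hxo : ∀ {x : V}, s(z, x) ∈ M ∪ u₀ → o ≠ x := fun {x} hx h => by
    subst h; rw [Sym2.eq_swap] at hx; exact hoz hx
  rcases Nat.lt_or_ge ((toFinite u₀).toFinset.filter fun g => z ∈ g).card 1 with hb0 | hb1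
  · -- three free pairs: the claw step under H1′
    have hzu := isolated_of_card_filter_eq_zero (M := u₀) (z := z) (by omega)
    obtain ⟨a, b, c, hza, hzb, hzc, hab, hac, hbc, haM, hbM, hcM', honly⟩ :=
      exists_of_card_filter_eq_three (z := z) hMd (by omega)
    have hab' : s(z, a) ≠ s(z, b) := fun h => hab (Sym2.congr_right.1 h)
    have hac' : s(z, a) ≠ s(z, c) := fun h => hac (Sym2.congr_right.1 h)
    have hbc' : s(z, b) ≠ s(z, c) := fun h => hbc (Sym2.congr_right.1 h)
    have h1 : s(z, a) ∉ insert s(z, b) (insert s(z, c) (M \ {s(z, a), s(z, b), s(z, c)})) := fun h => by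
      rcases mem_insert_iff.1 h with h | h
      · exact hab' h
      rcases mem_insert_iff.1 h with h | h
      · exact hac' h
      · exact h.2 (mem_insert _ _)
    have hM : insert s(z, a) (insert s(z, b) (insert s(z, c) (M \ {s(z, a), s(z, b), s(z, c)}))) = M := by
      ext g
      simp only [mem_insert_iff, mem_sdiff, mem_singleton_iff]
      constructor
      · rintro (rfl | rfl | rfl | ⟨hg, -⟩) <;> assumption
      · intro hg
        by_cases h1 : g = s(z, a)
        · exact Or.inl h1
        by_cases h2 : g = s(z, b)
        · exact Or.inr (Or.inl h2)
        by_cases h3 : g = s(z, c)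
        · exact Or.inr (Or.inr (Or.inl h3))
        · exact Or.inr (Or.inr (Or.inr ⟨hg, fun h => h.elim h1 (fun h => h.elim h2 h3)⟩))
    have hz' : ∀ g ∈ M \ {s(z, a), s(z, b), s(z, c)} ∪ u₀, z ∉ g := fun g hg hzg =>
      hg.elim (fun hg => hg.2 (honly g hg.1 hzg)) (fun hg => hzu g hg hzg)
    have hd' : Disjoint u₀ (M \ {s(z, a), s(z, b), s(z, c)}) := hd.mono_right sdiff_subset
    have hT' := hT_of (N := M \ {s(z, a), s(z, b), s(z, c)}) (u := u₀) (fun g hg => hg.elim (fun h => Or.inl h.1) Or.inr) hz'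
    have he' : s(o, v) ∈ M \ {s(z, a), s(z, b), s(z, c)} :=
      ⟨heM, fun h => by rcases h with h | h | h <;> exact he_ne _ h.symm⟩
    have hf' : s(o, y) ∈ M \ {s(z, a), s(z, b), s(z, c)} :=
      ⟨hfM, fun h => by rcases h with h | h | h <;> exact hf_ne _ h.symm⟩
    have key := twoCellBound_step_claw hH IH hd' hz' hza hzb hzc hab hac hbc (hxo (Or.inl haM)) (hxo (Or.inl hbM))
      (hxo (Or.inl hcM')) hzo hzv hzy hT' (memS (Or.inl haM)) (memS (Or.inl hbM)) (memS (Or.inl hcM')) he' hf' hvy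
    rw [hM] at key
    exact key
  · -- one pinned and one free pair: the mixed step
    obtain ⟨h, hzh, hzhU, honlyU⟩ := exists_of_card_filter_eq_one (z := z) (M := u₀) hUd (by omega)
    have hU : insert s(z, h) (u₀ \ {s(z, h)}) = u₀ := by rw [insert_sdiff_singleton, insert_eq_of_mem hzhU]
    have hUz : ∀ g ∈ u₀ \ {s(z, h)}, z ∉ g := fun g hg hzg => hg.2 (honlyU g hg.1 hzg)
    obtain ⟨i, hzi, hziM, honlyM⟩ := exists_of_card_filter_eq_one (z := z) hMd (by omega)
    have hhi : h ≠ i := fun h' => Set.disjoint_left.1 hd hzhU (h' ▸ hziM)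
    have hM : insert s(z, i) (M \ {s(z, i)}) = M := by rw [insert_sdiff_singleton, insert_eq_of_mem hziM]
    have hz' : ∀ g ∈ M \ {s(z, i)} ∪ (u₀ \ {s(z, h)}), z ∉ g := fun g hg hzg =>
      hg.elim (fun hg => hg.2 (honlyM g hg.1 hzg)) (fun hg => hUz g hg hzg)
    have hd' : Disjoint (u₀ \ {s(z, h)}) (M \ {s(z, i)}) := (hd.mono_left sdiff_subset).mono_right sdiff_subset
    have hT' := hT_of (N := M \ {s(z, i)}) (u := u₀ \ {s(z, h)})
      (fun g hg => hg.elim (fun h => Or.inl h.1) (fun h => Or.inr h.1)) hz'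
    have he' : s(o, v) ∈ M \ {s(z, i)} := ⟨heM, fun h' => he_ne _ h'.symm⟩
    have hf' : s(o, y) ∈ M \ {s(z, i)} := ⟨hfM, fun h' => hf_ne _ h'.symm⟩
    have key := node_step_mixed IH hd' hz' hzh hzi hhi hzo hzv hzy hT' (memS (Or.inr hzhU)) (memS (Or.inl hziM)) he' hf' hvy
    rw [hM, hU] at key
    exact key

end Far

end FK
end Summit.CriticalPhenomena.PercolationContinuityZ3.Theorems

end
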